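import Summits.CriticalPhenomena.PercolationContinuityZ3.Theorems.PercNearOneGluingNoHeavyLowerTailCubicFourPointL1Cells
import Mathlib.Tactic.Ring
import Mathlib.Tactic.Linarith
import HarnessLib

/-!
# `NoHeavyLowerTail` (stmt-CriticalPhenomena-4575) — the cut-vertex FACE of the polarised E3GRP form (L1): exact vanishing on the four rank-one components

Support file (prover prim-facecert, Engine-A client; `--supports stmt-CriticalPhenomena-4575`).  Pure algebra (`ring`), no sorries, no named
facts, no new definitions: everything is stated with prim-l12-p2's `HybMasses.ofCells` / `HybMasses.L1` / `E1` / `E2`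
(`…CubicFourPointL1Cells`, `…CubicFourPointL1Step`).

CONTEXT.  (L1) `= E3(D_bc,D_ac,G_ab) + E3(D_bc,G_ac,D_ab) − β₃·m(D_bc) ≥ 0` is census-exact on realizable 4-point laws and is TIGHT exactly on the
"cut-vertex face".  The facecert package (run/shared/lean/prim/prim-l12/prim-facecert/FACECERT-SPEC.md §3, Theorem F) identifies that face
algebraically: (L1) vanishes IDENTICALLY on exactly four maximal rank-one varieties of the 14-simplex of cell laws, each cut out by five
vanishing cells and the 2×2 minors of a 2×5 matrix of the remaining ten cells — the laws that FACTORISE across a marked cut vertex: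
* `V1 = CUT:a:b|cy`  — `a` separates `b` from `{c,y}`: law = (law of the `{a,b}` side) ⊗ (law of the `{a,c,y}` side), glued at `a`;
* `V2 = CUT:a:by|c`  — the `b ↔ c` mirror of `V1`;
* `V3 = CUT:b:ay|c`  — `b` separates `{a,y}` from `c`;
* `V4 = CUT:c:ay|b`  — the mirror of `V3`.
This file proves the four vanishing statements as ring identities in the side-law parameters (at total mass one on each side, since
`HybMasses.L1` has `σ = 1` built in), together with the SIGNATURE on `V3`/`V4`: there one hybrid row vanishes and the other equals the
product `β₃·m(D_bc)` (resp. on `V1`/`V2` both hybrid rows vanish).  These are the equality cases observed in ttrl2's census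
(bern4/README 'POLARIZATION L1/L2': classes {E1=0,E2=0}, {E1=0,E2=β₃m(D_bc)>0}, {E1=β₃m(D_bc)>0,E2=0}) — here as theorems for ALL points of the
four varieties, realizable or not.  Consequence used by the certificate programme (FACECERT-SPEC §5): every term of any Positivstellensatz
certificate of (L1) must vanish on `V1 ∪ V2 ∪ V3 ∪ V4` (exact presolve of the LP/SDP hierarchies).
NOT here: the converse (that these are the only zeros among realizable laws — census-grade), (L2), and any inequality.
-/

namespace Summit.CriticalPhenomena.PercolationContinuityZ3.Theorems

namespace HybMasses

open CubicThreePointStep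

variable {R : Type*} [CommRing R]

/-- **(L1) vanishes identically on `V1 = CUT:a:b|cy`.**  Side laws: `p₀ = m(a|b)`, `p₁ = m(ab)` on the `{a,b}` side and
`n₀,…,n₄ = m(a|c|y), m(a|cy), m(ay|c), m(ac|y), m(acy)` on the `{a,c,y}` side, each of total mass one; the 4-point cells are the products
(`«a|b|c|y» = p₀n₀`, `«ab|c|y» = p₁n₀`, …) and the five cells `a|by|c, a|bc|y, a|bcy, ay|bc, ac|by` (where `b` meets `c` or `y` without `a`) vanish. -/
theorem L1_cells_cut_a_b_cy (p₀ p₁ n₀ n₁ n₂ n₃ n₄ : R) (hp : p₀ + p₁ = 1) (hn : n₀ + n₁ + n₂ + n₃ + n₄ = 1) :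
    (ofCells (p₀ * n₀) (p₀ * n₁) 0 0 (p₀ * n₂) (p₀ * n₃) (p₁ * n₀) 0 0 0 (p₀ * n₄) (p₁ * n₁) (p₁ * n₂)).L1 = 0 := by
  have h1 : p₁ = 1 - p₀ := by rw [← hp]; ring
  have h2 : n₄ = 1 - n₀ - n₁ - n₂ - n₃ := by rw [← hn]; ring
  subst h1; subst h2
  simp only [ofCells, L1, E3h]; ring

/-- On `V1` both hybrid rows vanish: `E1 = 0` (and `β₃ = «a|bcy» = 0` by construction). -/
theorem E1_cells_cut_a_b_cy (p₀ p₁ n₀ n₁ n₂ n₃ n₄ : R) (hp : p₀ + p₁ = 1) (hn : n₀ + n₁ + n₂ + n₃ + n₄ = 1) :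
    (ofCells (p₀ * n₀) (p₀ * n₁) 0 0 (p₀ * n₂) (p₀ * n₃) (p₁ * n₀) 0 0 0 (p₀ * n₄) (p₁ * n₁) (p₁ * n₂)).E1 = 0 := by
  have h1 : p₁ = 1 - p₀ := by rw [← hp]; ring
  have h2 : n₄ = 1 - n₀ - n₁ - n₂ - n₃ := by rw [← hn]; ring
  subst h1; subst h2
  simp only [ofCells, E1, E3h]; ring

/-- On `V1` the second hybrid row vanishes too: `E2 = 0`. -/
theorem E2_cells_cut_a_b_cy (p₀ p₁ n₀ n₁ n₂ n₃ n₄ : R) (hp : p₀ + p₁ = 1) (hn : n₀ + n₁ + n₂ + n₃ + n₄ = 1) :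
    (ofCells (p₀ * n₀) (p₀ * n₁) 0 0 (p₀ * n₂) (p₀ * n₃) (p₁ * n₀) 0 0 0 (p₀ * n₄) (p₁ * n₁) (p₁ * n₂)).E2 = 0 := by
  have h1 : p₁ = 1 - p₀ := by rw [← hp]; ring
  have h2 : n₄ = 1 - n₀ - n₁ - n₂ - n₃ := by rw [← hn]; ring
  subst h1; subst h2
  simp only [ofCells, E2, E3h]; ring

/-- **(L1) vanishes identically on `V2 = CUT:a:by|c`** (the `b ↔ c` mirror of `V1`).  Side laws: `r₀,…,r₄ = m(a|b|y), m(a|by), m(ay|b),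
m(ab|y), m(aby)` on the `{a,b,y}` side, `s₀ = m(a|c)`, `s₁ = m(ac)` on the `{a,c}` side; the cells `a|b|cy, a|bc|y, a|bcy, ay|bc, ab|cy` vanish. -/
theorem L1_cells_cut_a_by_c (r₀ r₁ r₂ r₃ r₄ s₀ s₁ : R) (hr : r₀ + r₁ + r₂ + r₃ + r₄ = 1) (hs : s₀ + s₁ = 1) :
    (ofCells (r₀ * s₀) 0 (r₁ * s₀) 0 (r₂ * s₀) (r₀ * s₁) (r₃ * s₀) 0 0 (r₁ * s₁) (r₂ * s₁) 0 (r₄ * s₀)).L1 = 0 := by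
  have h1 : s₁ = 1 - s₀ := by rw [← hs]; ring
  have h2 : r₄ = 1 - r₀ - r₁ - r₂ - r₃ := by rw [← hr]; ring
  subst h1; subst h2
  simp only [ofCells, L1, E3h]; ring

/-- **(L1) vanishes identically on `V3 = CUT:b:ay|c`.**  Side laws: `m₀,…,m₄ = m(a|b|y), m(a|by), m(ay|b), m(ab|y), m(aby)` on the
`{a,y,b}` side, `g₀ = m(b|c)`, `g₁ = m(bc)` on the `{b,c}` side; the cells `a|b|cy, ac|b|y, ac|by, acy|b, ab|cy` (where `c` meets `a` or `y`
without `b`) vanish. -/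
theorem L1_cells_cut_b_ay_c (m₀ m₁ m₂ m₃ m₄ g₀ g₁ : R) (hm : m₀ + m₁ + m₂ + m₃ + m₄ = 1) (hg : g₀ + g₁ = 1) :
    (ofCells (m₀ * g₀) 0 (m₁ * g₀) (m₀ * g₁) (m₂ * g₀) 0 (m₃ * g₀) (m₁ * g₁) (m₂ * g₁) 0 0 0 (m₄ * g₀)).L1 = 0 := by
  have h1 : g₁ = 1 - g₀ := by rw [← hg]; ring
  have h2 : m₄ = 1 - m₀ - m₁ - m₂ - m₃ := by rw [← hm]; ring
  subst h1; subst h2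
  simp only [ofCells, L1, E3h]; ring

/-- **Signature on `V3`**: the first hybrid row vanishes, `E1 = E3(D_bc,D_ac,G_ab) = 0` … -/
theorem E1_cells_cut_b_ay_c (m₀ m₁ m₂ m₃ m₄ g₀ g₁ : R) (hm : m₀ + m₁ + m₂ + m₃ + m₄ = 1) (hg : g₀ + g₁ = 1) :
    (ofCells (m₀ * g₀) 0 (m₁ * g₀) (m₀ * g₁) (m₂ * g₀) 0 (m₃ * g₀) (m₁ * g₁) (m₂ * g₁) 0 0 0 (m₄ * g₀)).E1 = 0 := by
  have h1 : g₁ = 1 - g₀ := by rw [← hg]; ring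
  have h2 : m₄ = 1 - m₀ - m₁ - m₂ - m₃ := by rw [← hm]; ring
  subst h1; subst h2
  simp only [ofCells, E1, E3h]; ring

/-- … while the second equals the product term: `E2 = β₃ · m(D_bc)` on `V3` (so (L1) is tight there with the census signature
`{E1 = 0, E2 = β₃ m(D_bc) > 0}`). -/
theorem E2_cells_cut_b_ay_c (m₀ m₁ m₂ m₃ m₄ g₀ g₁ : R) (hm : m₀ + m₁ + m₂ + m₃ + m₄ = 1) (hg : g₀ + g₁ = 1) :
    (ofCells (m₀ * g₀) 0 (m₁ * g₀) (m₀ * g₁) (m₂ * g₀) 0 (m₃ * g₀) (m₁ * g₁) (m₂ * g₁) 0 0 0 (m₄ * g₀)).E2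
      = (ofCells (m₀ * g₀) 0 (m₁ * g₀) (m₀ * g₁) (m₂ * g₀) 0 (m₃ * g₀) (m₁ * g₁) (m₂ * g₁) 0 0 0 (m₄ * g₀)).β
        * (ofCells (m₀ * g₀) 0 (m₁ * g₀) (m₀ * g₁) (m₂ * g₀) 0 (m₃ * g₀) (m₁ * g₁) (m₂ * g₁) 0 0 0 (m₄ * g₀)).bc := by
  have h1 : g₁ = 1 - g₀ := by rw [← hg]; ring
  have h2 : m₄ = 1 - m₀ - m₁ - m₂ - m₃ := by rw [← hm]; ring
  subst h1; subst h2
  simp only [ofCells, E2, E3h]; ring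

/-- **(L1) vanishes identically on `V4 = CUT:c:ay|b`** (mirror of `V3`).  Side laws: `n₀,…,n₄ = m(a|c|y), m(a|cy), m(ay|c), m(ac|y), m(acy)`
on the `{a,y,c}` side, `g₀ = m(b|c)`, `g₁ = m(bc)`; the cells `a|by|c, ab|c|y, ac|by, ab|cy, aby|c` vanish. -/
theorem L1_cells_cut_c_ay_b (n₀ n₁ n₂ n₃ n₄ g₀ g₁ : R) (hn : n₀ + n₁ + n₂ + n₃ + n₄ = 1) (hg : g₀ + g₁ = 1) :
    (ofCells (n₀ * g₀) (n₁ * g₀) 0 (n₀ * g₁) (n₂ * g₀) (n₃ * g₀) 0 (n₁ * g₁) (n₂ * g₁) 0 (n₄ * g₀) 0 0).L1 = 0 := by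
  have h1 : g₁ = 1 - g₀ := by rw [← hg]; ring
  have h2 : n₄ = 1 - n₀ - n₁ - n₂ - n₃ := by rw [← hn]; ring
  subst h1; subst h2
  simp only [ofCells, L1, E3h]; ring

/-- **Signature on `V4`**: `E2 = 0` and `E1 = β₃ · m(D_bc)`. -/
theorem E1_cells_cut_c_ay_b (n₀ n₁ n₂ n₃ n₄ g₀ g₁ : R) (hn : n₀ + n₁ + n₂ + n₃ + n₄ = 1) (hg : g₀ + g₁ = 1) :
    (ofCells (n₀ * g₀) (n₁ * g₀) 0 (n₀ * g₁) (n₂ * g₀) (n₃ * g₀) 0 (n₁ * g₁) (n₂ * g₁) 0 (n₄ * g₀) 0 0).E2 = 0 ∧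
    (ofCells (n₀ * g₀) (n₁ * g₀) 0 (n₀ * g₁) (n₂ * g₀) (n₃ * g₀) 0 (n₁ * g₁) (n₂ * g₁) 0 (n₄ * g₀) 0 0).E1
      = (ofCells (n₀ * g₀) (n₁ * g₀) 0 (n₀ * g₁) (n₂ * g₀) (n₃ * g₀) 0 (n₁ * g₁) (n₂ * g₁) 0 (n₄ * g₀) 0 0).β
        * (ofCells (n₀ * g₀) (n₁ * g₀) 0 (n₀ * g₁) (n₂ * g₀) (n₃ * g₀) 0 (n₁ * g₁) (n₂ * g₁) 0 (n₄ * g₀) 0 0).bc := by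
  have h1 : g₁ = 1 - g₀ := by rw [← hg]; ring
  have h2 : n₄ = 1 - n₀ - n₁ - n₂ - n₃ := by rw [← hn]; ring
  subst h1; subst h2
  refine ⟨?_, ?_⟩
  · simp only [ofCells, E2, E3h]; ring
  · simp only [ofCells, E1, E3h]; ring

end HybMasses

end Summit.CriticalPhenomena.PercolationContinuityZ3.Theorems
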